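/-
Copyright (c) 2026 the pub-hodgecm-mathlib formalisation cell (harness21).  Prover seat hodgecm-mathlib-LH4-p04 (g8), req620 Track A «(D-RAM) FOUR-FRAME» squad
(STAGE-1b, row (2) of the piece `f_{T₊}`, the (β₂) road; dealer∕pen LH4-plan (g13) WORD #108 (4) ∕ WORD #112 (1): «(S4) β₂ ASSEMBLY», LH4-p04 lineage; brick (S4-OF)), 2026-09-04.
-/
import Summits.HodgeConjecture.HodgeConjecture.Theorems.F0P3cDyRamBlockCensusOrderForm    -- ★ (C1) (LH4-p12 (g4)): `finsum_ncard_glueFibre_eq_sum_levelSetDep`'s letters; brings ★ p857411 `finsum_coneWParts_eq_sum`, ★ `ncard_glueFibre_eq_natCard_normFibre_of_gen`, ★ `exists_map_eq_glueUnit`, ★ DEFS `levelSet ∕ levelSetDep ∕ glueUnit`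
import Summits.HodgeConjecture.HodgeConjecture.Theorems.F0P3cDyRamBlockGlueLabelledCount  -- ★ p860968 (this seat, (S4-glue)): `ncard_fixed_selfDual_endoGL_sep_eq_plane_add_sum` (labelled glue count, axis on the plane)
import HarnessLib

/-!
# Crux `H413`, line LH4 «(D-RAM) FOUR-FRAME» — STAGE-1b, row (2), the (β₂) road, brick (S4-OF): «THE LABELLED BLOCK CENSUS IN M-LETTERS»
# `#{M self-dual ∣ Γ·M = M, Q M} = #{B₂ ∣ SD, γ₂B₂ = B₂, Q₂ B₂} + Σ_{b ∈ [1,R]} Σ_{j ≤ J} [lam ∈ 𝒪_j]·Σᶠ_{Λ ∈ levelSetDep(j, b; lam − jE u) ∧ q b j Λ} f b j Λ`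

Cell `hodgecm-mathlib` (D-0151), FLOOR 0, crux item H413 = `stmt-HodgeConjecture-24833`, route of record `HCCMUnconditional`; squad F0∕P3c∕LH4; lane
`--supports stmt-HodgeConjecture-24833 --as helper` (count-neutral; pays NO tier-0 row).  THEOREMS ONLY (no `def`, no instance, no notation, no `sorry`, default heartbeats).
DATUM-FREE: abstract valued fields `E` (the plane) and `M` (the line model), `𝒪_E` a PID; no residue field, no `|2|`.

WHY.  The (S4) assembly of the (β₂) letter (`betaT2lit.letter.v1` ecb8685d after ★ p860931) compares LABELLED fixed-vertex counts `T₊`, `T−′` of two unitary block elements, and every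
per-cell producer ((β₂-S) GENERIC cells — LH4-p13 (g8) part ii; (β₂-H) SPECIFIC cells — ★ p860765 ∕ p860839, LH4-p09 (g9), LH4-p11 (g8)) speaks the M-LETTERS of ★ DEFS
`F0P3cDyRamToricCensusDefs`: cone cells `levelSet ∕ levelSetDep (j, b; μ)` of the line model `(M, jE, ρ, Θ, α; φ, lam, h)` with ONE LABEL BIT PER `(Λ, b)` (★ p861015-cand
`…BlockGlueLabelFibreConstant`: near `1` the `f_{T₊}` predicates are fibre-constant).  The UNLABELLED bridge is ★ (C1) `…BlockCensusOrderForm.ncard_fixed_selfDual_endoGL_eq_orderForm`;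
THIS FILE is its LABELLED twin on the cone layers (the axis term stays on the plane, as ★ p860968 §3 leaves it; its M-reading is ★ (C)∕W4 business, next brick):
* §0 `finsum_mem_sep_eq_finsum_mem_ite` — `Σᶠ_{x ∈ {x ∣ A x ∧ P x}} F x = Σᶠ_{x ∈ {x ∣ A x}} (if P x then F x else 0)` (indicator bookkeeping).
* §1 `finsum_ncard_glueFibre_sep_eq_sum_levelSetDep` — LABELLED CONE LAYER `b ≥ 1`: for a plane label `P₂` and M-labels `q j` that AGREE on presented cells (`hq : φ(B₂) ∈
  levelSetDep(j, b; lam − jE u) → lam ∈ 𝒪_j → (P₂ B₂ ↔ q j φ(B₂))`) and a weight `f` agreeing with `#Sol_{2b}(r)` on presented cells (★ (C1)'s `hf` VERBATIM):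
  `Σᶠ_{B₂ ∈ S_b ∧ P₂ B₂} #fibre(ι_W B₂, b) = Σ_{j < J+1} [IsOrd (jE ϖ^j) lam]·Σᶠ_{Λ ∈ levelSetDep(j, b; lam − jE u) ∩ {Λ ∣ q j Λ}} f b j Λ` — ★ p857411 `finsum_coneWParts_eq_sum` at the
  weight `g B₂ := [P₂ B₂]·#fibre`, `hfg` by `hq` ⊕ ★ `ncard_glueFibre_eq_natCard_normFibre_of_gen` ⊕ `hf` (★ (C1) §2's discharge, token for token).
* §2 HEAD `ncard_fixed_selfDual_endoGL_sep_eq_orderForm` — ★ p860968 §3 ⊕ §1 per layer: for a FIBRE-CONSTANT `Q` (★ p860968's `hQ`), an axis label `Q₂` (★ p860968's `hQ₂`) and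
  M-labels `q b j` with the dictionary `hq` at `P₂ := Q̂_b` (★ p860968's labelled index predicate `∃ M, SD ∧ M ∩ W = ι_W B₂ ∧ tube b ∧ Q M`):
  `#{M ∣ SD, Γ·M = M, Q M} = #{B₂ ∣ SD for H₂, γ₂B₂ = B₂, Q₂ B₂} + Σ_{b ∈ Icc 1 R} Σ_{j < J+1} [IsOrd (jE ϖ^j) lam]·Σᶠ_{Λ ∈ levelSetDep(j, b; lam − jE u₀₀) ∩ {q b j}} f b j Λ`.
  At `Q, Q₂, q := ⊤` this is ★ (C1)'s HEAD with the axis un-translated.  The dictionary `hq` is where the LABEL FACE plugs (the class of the glued vertex's value set over `φ(B₂)` read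
  in M-letters: ★ p860233 §5 `map_pairing_endoGL_sub_one_glued_eq_trace`, LH4-p13 (g8) `planeTerm_eq_pairing_sub_one`); nothing about it is asserted here.
HONEST LABEL.  Count-neutral lattice bookkeeping; nothing printed is asserted; no census law is stated; (β₂) ∕ `betaT2lit` stay HYPOTHESES; `HC_CM` is proved only modulo the
7 printed citations (2 remaining named inputs: hLiu418 = `stmt-HodgeConjecture-24832`, h413 = `stmt-HodgeConjecture-24833`) until rung 0 closes.
## References
* [Kottwitz1986BaseChangeUnits] R. E. Kottwitz, *Base change for unit elements of Hecke algebras*, Compositio Math. 60 (1986), §1 pp. 240–241.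
* [BruhatTits1972] F. Bruhat, J. Tits, *Groupes réductifs sur un corps local I*, Publ. Math. IHÉS 41 (1972), §10 (lattice models of the rank-one building; tube layers).
* [Jacobowitz1962] R. Jacobowitz, *Hermitian forms over local fields*, Amer. J. Math. 84 (1962), §4 (dual lattices, gluing of modular components).
* [Flicker1998UnitaryFL] Y. Z. Flicker, *Elementary proof of the fundamental lemma for a unitary group*, Canad. J. Math. 50 (1998), p. 84 REMARK.
-/

set_option autoImplicit false

noncomputable section

open scoped Valued WithZero Matrix MatrixGroups
open WithZero
open scoped Classical
open Literature.NumberTheory.Automorphic Literature.NumberTheory.Automorphic.HermitianLattice Literature.NumberTheory.Automorphic.UnitaryLatticeTree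
open Literature.NumberTheory.Rogawski1990
open Literature.NumberTheory.Automorphic.EllipticPlaneAsFieldLine
open Literature.NumberTheory.LocalFields.QuadraticOrder
open Summit.HodgeConjecture.HodgeConjecture.Cruxes.H413.F0P3cDyRamToricCensusDefs
open Summit.HodgeConjecture.HodgeConjecture.Cruxes.H413.F0P3cDyRamWSideOrderCensus
open Summit.HodgeConjecture.HodgeConjecture.Cruxes.H413.F0P3cDyRamConeLevelTransport
open Summit.HodgeConjecture.HodgeConjecture.Cruxes.H413.F0P3cDyRamBlockGlueCount
open Summit.HodgeConjecture.HodgeConjecture.Cruxes.H413.F0P3cDyRamBlockCensusOrderForm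
open Summit.HodgeConjecture.HodgeConjecture.Cruxes.H413.F0P3cDyRamBlockGlueLabelledCount

namespace Summit.HodgeConjecture.HodgeConjecture.Cruxes.H413.F0P3cDyRamBlockCensusOrderFormLabelled

/-! ## §0 Indicator bookkeeping -/

/-- `Σᶠ_{x ∈ {A ∧ P}} F = Σᶠ_{x ∈ {A}} (if P then F else 0)`. [cite: Kottwitz1986BaseChangeUnits, §1 pp. 240–241] -/
theorem finsum_mem_sep_eq_finsum_mem_ite {ι N : Type*} [AddCommMonoid N] (A P : ι → Prop) (F : ι → N) :
    ∑ᶠ x ∈ {x | A x ∧ P x}, F x = ∑ᶠ x ∈ {x | A x}, (if P x then F x else 0) := by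
  classical
  have hset : {x | A x ∧ P x} = {x | A x} ∩ {x | P x} := by ext x; simp only [Set.mem_setOf_eq, Set.mem_inter_iff]
  rw [hset, finsum_mem_def, finsum_mem_def, ← Set.indicator_indicator]
  refine finsum_congr fun x => ?_
  by_cases hA : x ∈ {x | A x}
  · rw [Set.indicator_of_mem hA, Set.indicator_of_mem hA, Set.indicator_apply]
    rfl
  · rw [Set.indicator_of_notMem hA, Set.indicator_of_notMem hA]

variable {E M : Type*} [Field E] [Valued E ℤᵐ⁰] [Field M] [Valued M ℤᵐ⁰] {ρ Θ : M →+* M} {α : M}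

/-! ## §1 The labelled cone layer `b ≥ 1` in M-letters -/

/-- **LABELLED CONE LAYER `b ≥ 1` IN M-LETTERS.**  ★ (C1) `finsum_ncard_glueFibre_eq_sum_levelSetDep`'s frame VERBATIM (block form, line model, weight `f` agreeing with
`#Sol_{2b}(r)` on presented cells), plus a plane label `P₂` and M-labels `q j` that agree on presented cells (`hq`).  Then
`Σᶠ_{B₂ ∈ S_b ∧ P₂ B₂} #fibre(ι_W B₂, b) = Σ_{j < J+1} [IsOrd (jE ϖ^j) lam]·Σᶠ_{Λ ∈ levelSetDep(j, b; lam − jE u) ∩ {Λ ∣ q j Λ}} f b j Λ`.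
[cite: Kottwitz1986BaseChangeUnits, §1 pp. 240–241] [cite: BruhatTits1972, §10] [cite: Jacobowitz1962, §4] -/
theorem finsum_ncard_glueFibre_sep_eq_sum_levelSetDep [IsPrincipalIdealRing 𝒪[E]] (σ : E →+* E) (hσ : ∀ a, σ (σ a) = a) (hvσ : ∀ a, Valued.v (σ a) = Valued.v a)
    {ϖ : E} (hϖ : Valued.v ϖ = WithZero.exp (-1 : ℤ))
    {H₂ : Matrix (Fin 2) (Fin 2) E} (hH₂ : IsUnit H₂.det) (hH₂σ : (H₂.map σ)ᵀ = H₂) {hW : E} (hhW : Valued.v hW = 1) (hhWσ : σ hW = hW) (jE : E →+* M)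
    (hρρ : ∀ x, ρ (ρ x) = x) (hvρ : ∀ x, Valued.v (ρ x) = Valued.v x) (hα : ρ α ≠ α) (hα1 : Valued.v α ≤ 1)
    (hint : ∀ z : M, Valued.v z ≤ 1 → Valued.v ((z - ρ z) / (α - ρ α)) ≤ 1)
    (hΘΘ : ∀ x, Θ (Θ x) = x) (hΘρ : ∀ x, Θ (ρ x) = ρ (Θ x)) (hvΘ : ∀ x, Valued.v (Θ x) = Valued.v x) (hΘj : ∀ x, Θ (jE x) = jE (σ x))
    (hjv : ∀ c, Valued.v (jE c) ≤ 1 ↔ Valued.v c ≤ 1) (hjfix : ∀ z, ρ z = z ↔ ∃ c, jE c = z)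
    (hjpow : ∀ (t : E) (n : ℤ), Valued.v (jE t) = Valued.v (jE ϖ) ^ n ↔ Valued.v t = Valued.v ϖ ^ n)
    (hEval : ∀ c : M, ρ c = c → c ≠ 0 → Valued.v c ≤ 1 → ∃ n : ℕ, Valued.v c = Valued.v (jE ϖ) ^ n)
    (hϖmax : ∀ t : M, ρ t = t → Valued.v t < 1 → Valued.v t ≤ Valued.v (jE ϖ))
    (φ : (Fin 2 → E) →+ M) (hφs : ∀ (c : E) (x : Fin 2 → E), φ (c • x) = jE c * φ x) (hφi : Function.Injective φ) (hφo : Function.Surjective φ)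
    {γ₂ : GL (Fin 2) E} {lam h : M} (hφγ : ∀ x, φ ((γ₂ : Matrix (Fin 2) (Fin 2) E).mulVec x) = lam * φ x) (hlam : Valued.v lam = 1)
    (hΘh : Θ h = h) (hh : h ≠ 0) (hform : ∀ x y, jE (pairing σ H₂ x y) = h * Θ (φ x) * φ y + ρ (h * Θ (φ x) * φ y))
    (u : E) (hu : Valued.v u ≤ 1) {b : ℕ} (hb : 1 ≤ b) {J : ℕ} (hJ : ¬ IsOrd ρ α (jE ϖ ^ (J + 1)) lam)
    (hfin : ∀ j, j ≤ J → (levelSet ρ Θ α (jE ϖ) h j b).Finite)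
    (f : ℕ → ℕ → AddSubgroup M → ℕ)
    (hf : ∀ (b j : ℕ) (Λ : AddSubgroup M) (x₀ : M) (r : E), 1 ≤ b → x₀ ≠ 0 →
      (∀ x, x ∈ Λ ↔ ∃ z, IsOrd ρ α (jE ϖ ^ j) z ∧ x = x₀ * z) →
      IsOrd ρ α (jE ϖ ^ j) (dualGen ρ Θ α (jE ϖ ^ j) h x₀) → ¬ IsOrd ρ α (jE ϖ ^ j) (dualGen ρ Θ α (jE ϖ ^ j) h x₀ / jE ϖ) →
      Valued.v (dualGen ρ Θ α (jE ϖ ^ j) h x₀) = Valued.v (jE ϖ) ^ b →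
      (∀ b', (∀ x ∈ Λ, Valued.v (h * Θ x * b' + ρ (h * Θ x * b')) ≤ 1) → (lam - jE u) * b' ∈ Λ) →
      IsOrd ρ α (jE ϖ ^ j) lam → jE r = glueUnit ρ Θ α (jE ϖ ^ j) h (jE ϖ) (jE hW) x₀ b →
      f b j Λ = Nat.card {x : 𝒪[E] ⧸ 𝓂[E] ^ (2 * b) // ∃ u' : 𝒪[E], Ideal.Quotient.mk (𝓂[E] ^ (2 * b)) u' = x ∧
        Valued.v ((u' : E) * σ u' - r) ≤ Valued.v (ϖ ^ (2 * b))})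
    (P₂ : Submodule 𝒪[E] (Fin 2 → E) → Prop) (q : ℕ → AddSubgroup M → Prop)
    (hq : ∀ (j : ℕ) (B : Submodule 𝒪[E] (Fin 2 → E)), B.toAddSubgroup.map φ ∈ levelSetDep ρ Θ α (jE ϖ) h j b (lam - jE u) → IsOrd ρ α (jE ϖ ^ j) lam →
      (P₂ B ↔ q j (B.toAddSubgroup.map φ))) :
    ∑ᶠ B₂ ∈ {B : Submodule 𝒪[E] (Fin 2 → E) | ((∃ g : GL (Fin 2) E, B = latt (g : Matrix (Fin 2) (Fin 2) E)) ∧ mapGL γ₂ B = B ∧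
        ∃ w₀ : Fin 2 → E, (∀ w, w ∈ B ↔ (w ∈ dualLatt σ H₂ B ∧ Valued.v (pairing σ H₂ w₀ w) ≤ 1)) ∧
          (∀ w ∈ dualLatt σ H₂ B, ∃ (t : E) (a : Fin 2 → E), Valued.v t ≤ 1 ∧ a ∈ B ∧ w = t • w₀ + a) ∧
          Valued.v (pairing σ H₂ w₀ w₀) * Valued.v ϖ ^ (2 * b) = 1 ∧ (γ₂ : Matrix (Fin 2) (Fin 2) E).mulVec w₀ - u • w₀ ∈ B) ∧ P₂ B},
        {L : Submodule 𝒪[E] (Fin 3 → E) | IsSelfDualLattice σ ϖ (!![H₂ 0 0, 0, H₂ 0 1; 0, hW, 0; H₂ 1 0, 0, H₂ 1 1] : Matrix (Fin 3) (Fin 3) E) L ∧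
            L ⊓ LinearMap.ker ((LinearMap.proj (1 : Fin 3) : (Fin 3 → E) →ₗ[E] E).restrictScalars 𝒪[E]) =
              B₂.map ((Matrix.toLin' (!![1, 0; 0, 0; 0, 1] : Matrix (Fin 3) (Fin 2) E)).restrictScalars 𝒪[E]) ∧
            ∀ c : E, (Pi.single 1 c : Fin 3 → E) ∈ L ↔ Valued.v c ≤ Valued.v ϖ ^ b}.ncard =
      ∑ j ∈ Finset.range (J + 1), (if IsOrd ρ α (jE ϖ ^ j) lam then
        ∑ᶠ Λ ∈ levelSetDep ρ Θ α (jE ϖ) h j b (lam - jE u) ∩ {Λ | q j Λ}, f b j Λ else 0) := by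
  have hvϖ0 : Valued.v ϖ ≠ 0 := by rw [hϖ]; exact WithZero.exp_ne_zero
  have hϖ0 : ϖ ≠ 0 := fun h0 => by rw [h0, map_zero] at hvϖ0; exact hvϖ0 rfl
  have hϖ1 : Valued.v ϖ < 1 := by rw [hϖ, ← WithZero.exp_zero, WithZero.exp_lt_exp]; norm_num
  -- the labelled index set as an indicator weight on the cone index set
  rw [finsum_mem_sep_eq_finsum_mem_ite]
  -- the labelled cells as indicator weights on the cone cells
  have hcell : ∀ j, (∑ᶠ Λ ∈ levelSetDep ρ Θ α (jE ϖ) h j b (lam - jE u) ∩ {Λ | q j Λ}, f b j Λ) =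
      ∑ᶠ Λ ∈ levelSetDep ρ Θ α (jE ϖ) h j b (lam - jE u), (if q j Λ then f b j Λ else 0) := by
    intro j
    have hset : levelSetDep ρ Θ α (jE ϖ) h j b (lam - jE u) ∩ {Λ | q j Λ} = {Λ | Λ ∈ levelSetDep ρ Θ α (jE ϖ) h j b (lam - jE u) ∧ q j Λ} := by
      ext Λ; simp only [Set.mem_inter_iff, Set.mem_setOf_eq]
    rw [hset, finsum_mem_sep_eq_finsum_mem_ite]
    rfl
  simp_rw [hcell]
  -- ★ p857411 with the indicator weights; `hfg` per presented cell
  refine finsum_coneWParts_eq_sum σ hϖ0 hϖ1 H₂ jE hρρ hvρ hα hα1 hint hΘΘ hΘρ hvΘ hjv hjfix hjpow hEval hϖmax φ hφs hφi hφo hφγ hlam hΘh hh hform hu hb hJ hfin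
    _ (fun j Λ => if q j Λ then f b j Λ else 0) fun j B₂ hBdep hlamj => ?_
  have hPq : P₂ B₂ ↔ q j (B₂.toAddSubgroup.map φ) := hq j B₂ hBdep hlamj
  by_cases hP : P₂ B₂
  · rw [if_pos hP, if_pos (hPq.1 hP)]
    -- the unlabelled per-cell identity (★ (C1) §2's discharge, token for token)
    obtain ⟨⟨x₀, hx₀, hΛx, hyO, hyprim, hylev⟩, hdepΛ⟩ := hBdep
    obtain ⟨r, hr⟩ := exists_map_eq_glueUnit (ρ := ρ) (Θ := Θ) (α := α) jE hρρ hΘρ hjfix (jE ϖ ^ j) h x₀ ϖ hW b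
    rw [ncard_glueFibre_eq_natCard_normFibre_of_gen σ hσ hvσ hϖ hH₂ hH₂σ hhW hhWσ jE hρρ hvρ hα hα1 hint hΘΘ hΘρ hvΘ hΘj hjv hjfix hjpow hϖmax φ hφs hφi hφo hφγ hlam
        hΘh hh hform u hb hx₀ hΛx hyO hyprim hylev hdepΛ hlamj hr,
      hf b j _ x₀ r hb hx₀ hΛx hyO hyprim hylev hdepΛ hlamj hr]
  · rw [if_neg hP, if_neg (fun hq' => hP (hPq.2 hq'))]

/-! ## §2 HEAD — the labelled block census, cone layers in M-letters -/

/-- **(S4-OF) THE LABELLED BLOCK CENSUS, CONE LAYERS IN M-LETTERS (HEAD).**  Block form `H = block(H₂, h_W)` over `E`, `Γ = endoGL (γ₂, u)` UNITARY for `H` (`|u₀₀| = 1`), the line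
model `(M, jE, ρ, Θ, α; φ, lam, h)` of `(H₂, γ₂)`, the fixed self-dual family finite with tube coordinates `≤ R`, `lam ∉ 𝒪_{J+1}`, the level sets finite, a weight `f` agreeing with
`#Sol_{2b}(r)` on presented cells (★ (C1)'s `hf`); a side condition `Q` FIBRE-CONSTANT on every layer `b ≥ 1` (★ p860968's `hQ`), an axis label `Q₂` reading `Q` on the axis vertices
(★ p860968's `hQ₂`), and M-labels `q b j` agreeing with `Q̂_b` on presented cells (`hq`).  THEN
`#{M ∣ SD, Γ·M = M, Q M} = #{B₂ ∣ SD for H₂, γ₂B₂ = B₂, Q₂ B₂} + Σ_{b ∈ Icc 1 R} Σ_{j < J+1} [IsOrd (jE ϖ^j) lam]·Σᶠ_{Λ ∈ levelSetDep(j, b; lam − jE u₀₀) ∩ {q b j}} f b j Λ`.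
[cite: Kottwitz1986BaseChangeUnits, §1 pp. 240–241] [cite: BruhatTits1972, §10] [cite: Jacobowitz1962, §4] [cite: Flicker1998UnitaryFL, p. 84 REMARK] -/
theorem ncard_fixed_selfDual_endoGL_sep_eq_orderForm [IsPrincipalIdealRing 𝒪[E]] (σ : E →+* E) (hσ : ∀ a, σ (σ a) = a) (hvσ : ∀ a, Valued.v (σ a) = Valued.v a)
    {ϖ : E} (hϖ : Valued.v ϖ = WithZero.exp (-1 : ℤ))
    {H₂ : Matrix (Fin 2) (Fin 2) E} (hH₂ : IsUnit H₂.det) (hH₂σ : (H₂.map σ)ᵀ = H₂) {hW : E} (hhW : Valued.v hW = 1) (hhWσ : σ hW = hW) (jE : E →+* M)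
    (hρρ : ∀ x, ρ (ρ x) = x) (hvρ : ∀ x, Valued.v (ρ x) = Valued.v x) (hα : ρ α ≠ α) (hα1 : Valued.v α ≤ 1)
    (hint : ∀ z : M, Valued.v z ≤ 1 → Valued.v ((z - ρ z) / (α - ρ α)) ≤ 1)
    (hΘΘ : ∀ x, Θ (Θ x) = x) (hΘρ : ∀ x, Θ (ρ x) = ρ (Θ x)) (hvΘ : ∀ x, Valued.v (Θ x) = Valued.v x) (hΘj : ∀ x, Θ (jE x) = jE (σ x))
    (hjv : ∀ c, Valued.v (jE c) ≤ 1 ↔ Valued.v c ≤ 1) (hjfix : ∀ z, ρ z = z ↔ ∃ c, jE c = z)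
    (hjpow : ∀ (t : E) (n : ℤ), Valued.v (jE t) = Valued.v (jE ϖ) ^ n ↔ Valued.v t = Valued.v ϖ ^ n)
    (hEval : ∀ c : M, ρ c = c → c ≠ 0 → Valued.v c ≤ 1 → ∃ n : ℕ, Valued.v c = Valued.v (jE ϖ) ^ n)
    (hϖmax : ∀ t : M, ρ t = t → Valued.v t < 1 → Valued.v t ≤ Valued.v (jE ϖ))
    (φ : (Fin 2 → E) →+ M) (hφs : ∀ (c : E) (x : Fin 2 → E), φ (c • x) = jE c * φ x) (hφi : Function.Injective φ) (hφo : Function.Surjective φ)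
    {γ₂ : GL (Fin 2) E} {lam h : M} (hφγ : ∀ x, φ ((γ₂ : Matrix (Fin 2) (Fin 2) E).mulVec x) = lam * φ x) (hlam : Valued.v lam = 1)
    (hΘh : Θ h = h) (hh : h ≠ 0) (hform : ∀ x y, jE (pairing σ H₂ x y) = h * Θ (φ x) * φ y + ρ (h * Θ (φ x) * φ y))
    (u : GL (Fin 1) E) (hΓ : endoGL (γ₂, u) ∈ unitaryGroupOfForm σ (!![H₂ 0 0, 0, H₂ 0 1; 0, hW, 0; H₂ 1 0, 0, H₂ 1 1] : Matrix (Fin 3) (Fin 3) E))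
    (hu : Valued.v ((u : Matrix (Fin 1) (Fin 1) E) 0 0) = 1) {R : ℕ}
    (hfinF : {L : Submodule 𝒪[E] (Fin 3 → E) |
      IsSelfDualLattice σ ϖ (!![H₂ 0 0, 0, H₂ 0 1; 0, hW, 0; H₂ 1 0, 0, H₂ 1 1] : Matrix (Fin 3) (Fin 3) E) L ∧ mapGL (endoGL (γ₂, u)) L = L}.Finite)
    (hR : ∀ L : Submodule 𝒪[E] (Fin 3 → E), IsSelfDualLattice σ ϖ (!![H₂ 0 0, 0, H₂ 0 1; 0, hW, 0; H₂ 1 0, 0, H₂ 1 1] : Matrix (Fin 3) (Fin 3) E) L →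
      mapGL (endoGL (γ₂, u)) L = L → ∀ b : ℕ, (∀ c : E, (Pi.single 1 c : Fin 3 → E) ∈ L ↔ Valued.v c ≤ Valued.v ϖ ^ b) → b ≤ R)
    {J : ℕ} (hJ : ¬ IsOrd ρ α (jE ϖ ^ (J + 1)) lam) (hfinLS : ∀ j a, (levelSet ρ Θ α (jE ϖ) h j a).Finite)
    (f : ℕ → ℕ → AddSubgroup M → ℕ)
    (hf : ∀ (b j : ℕ) (Λ : AddSubgroup M) (x₀ : M) (r : E), 1 ≤ b → x₀ ≠ 0 →
      (∀ x, x ∈ Λ ↔ ∃ z, IsOrd ρ α (jE ϖ ^ j) z ∧ x = x₀ * z) →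
      IsOrd ρ α (jE ϖ ^ j) (dualGen ρ Θ α (jE ϖ ^ j) h x₀) → ¬ IsOrd ρ α (jE ϖ ^ j) (dualGen ρ Θ α (jE ϖ ^ j) h x₀ / jE ϖ) →
      Valued.v (dualGen ρ Θ α (jE ϖ ^ j) h x₀) = Valued.v (jE ϖ) ^ b →
      (∀ b', (∀ x ∈ Λ, Valued.v (h * Θ x * b' + ρ (h * Θ x * b')) ≤ 1) → (lam - jE ((u : Matrix (Fin 1) (Fin 1) E) 0 0)) * b' ∈ Λ) →
      IsOrd ρ α (jE ϖ ^ j) lam → jE r = glueUnit ρ Θ α (jE ϖ ^ j) h (jE ϖ) (jE hW) x₀ b →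
      f b j Λ = Nat.card {x : 𝒪[E] ⧸ 𝓂[E] ^ (2 * b) // ∃ u' : 𝒪[E], Ideal.Quotient.mk (𝓂[E] ^ (2 * b)) u' = x ∧
        Valued.v ((u' : E) * σ u' - r) ≤ Valued.v (ϖ ^ (2 * b))})
    (Q : Submodule 𝒪[E] (Fin 3 → E) → Prop)
    (hQ : ∀ (b : ℕ), 1 ≤ b → ∀ L L' : Submodule 𝒪[E] (Fin 3 → E),
      IsSelfDualLattice σ ϖ (!![H₂ 0 0, 0, H₂ 0 1; 0, hW, 0; H₂ 1 0, 0, H₂ 1 1] : Matrix (Fin 3) (Fin 3) E) L →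
      IsSelfDualLattice σ ϖ (!![H₂ 0 0, 0, H₂ 0 1; 0, hW, 0; H₂ 1 0, 0, H₂ 1 1] : Matrix (Fin 3) (Fin 3) E) L' →
      (∀ c : E, (Pi.single 1 c : Fin 3 → E) ∈ L ↔ Valued.v c ≤ Valued.v ϖ ^ b) → (∀ c : E, (Pi.single 1 c : Fin 3 → E) ∈ L' ↔ Valued.v c ≤ Valued.v ϖ ^ b) →
      L ⊓ LinearMap.ker ((LinearMap.proj (1 : Fin 3) : (Fin 3 → E) →ₗ[E] E).restrictScalars 𝒪[E]) =
        L' ⊓ LinearMap.ker ((LinearMap.proj (1 : Fin 3) : (Fin 3 → E) →ₗ[E] E).restrictScalars 𝒪[E]) → Q L → Q L')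
    (Q₂ : Submodule 𝒪[E] (Fin 2 → E) → Prop)
    (hQ₂ : ∀ g₂ : GL (Fin 2) E, Q (latt ((endoGL (g₂, (1 : GL (Fin 1) E)) : GL (Fin 3) E) : Matrix (Fin 3) (Fin 3) E)) ↔ Q₂ (latt (g₂ : Matrix (Fin 2) (Fin 2) E)))
    (q : ℕ → ℕ → AddSubgroup M → Prop)
    (hq : ∀ (b j : ℕ) (B : Submodule 𝒪[E] (Fin 2 → E)), 1 ≤ b →
      B.toAddSubgroup.map φ ∈ levelSetDep ρ Θ α (jE ϖ) h j b (lam - jE ((u : Matrix (Fin 1) (Fin 1) E) 0 0)) → IsOrd ρ α (jE ϖ ^ j) lam →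
      ((∃ L : Submodule 𝒪[E] (Fin 3 → E), IsSelfDualLattice σ ϖ (!![H₂ 0 0, 0, H₂ 0 1; 0, hW, 0; H₂ 1 0, 0, H₂ 1 1] : Matrix (Fin 3) (Fin 3) E) L ∧
          L ⊓ LinearMap.ker ((LinearMap.proj (1 : Fin 3) : (Fin 3 → E) →ₗ[E] E).restrictScalars 𝒪[E]) =
            B.map ((Matrix.toLin' (!![1, 0; 0, 0; 0, 1] : Matrix (Fin 3) (Fin 2) E)).restrictScalars 𝒪[E]) ∧
          (∀ c : E, (Pi.single 1 c : Fin 3 → E) ∈ L ↔ Valued.v c ≤ Valued.v ϖ ^ b) ∧ Q L) ↔ q b j (B.toAddSubgroup.map φ))) :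
    {L : Submodule 𝒪[E] (Fin 3 → E) |
        IsSelfDualLattice σ ϖ (!![H₂ 0 0, 0, H₂ 0 1; 0, hW, 0; H₂ 1 0, 0, H₂ 1 1] : Matrix (Fin 3) (Fin 3) E) L ∧ (mapGL (endoGL (γ₂, u)) L = L ∧ Q L)}.ncard =
      {B₂ : Submodule 𝒪[E] (Fin 2 → E) | IsSelfDualLattice σ ϖ H₂ B₂ ∧ mapGL γ₂ B₂ = B₂ ∧ Q₂ B₂}.ncard +
        ∑ b ∈ Finset.Icc 1 R, ∑ j ∈ Finset.range (J + 1),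
          (if IsOrd ρ α (jE ϖ ^ j) lam then
            ∑ᶠ Λ ∈ levelSetDep ρ Θ α (jE ϖ) h j b (lam - jE ((u : Matrix (Fin 1) (Fin 1) E) 0 0)) ∩ {Λ | q b j Λ}, f b j Λ else 0) := by
  -- ★ p860968 §3: labelled axis on the plane + labelled cone layers through the plane
  rw [ncard_fixed_selfDual_endoGL_sep_eq_plane_add_sum σ hσ hvσ hϖ hH₂ hH₂σ hhW γ₂ u hΓ hu hfinF hR Q hQ Q₂ hQ₂]
  -- §1: each labelled cone layer in M-letters
  congr 1
  refine Finset.sum_congr rfl fun b hb => ?_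
  exact finsum_ncard_glueFibre_sep_eq_sum_levelSetDep σ hσ hvσ hϖ hH₂ hH₂σ hhW hhWσ jE hρρ hvρ hα hα1 hint hΘΘ hΘρ hvΘ hΘj hjv hjfix hjpow hEval hϖmax φ hφs hφi hφo hφγ hlam
    hΘh hh hform ((u : Matrix (Fin 1) (Fin 1) E) 0 0) hu.le (Finset.mem_Icc.1 hb).1 hJ (fun j _ => hfinLS j b) f hf _ (q b)
    (fun j B hB hl => hq b j B (Finset.mem_Icc.1 hb).1 hB hl)

end Summit.HodgeConjecture.HodgeConjecture.Cruxes.H413.F0P3cDyRamBlockCensusOrderFormLabelled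

end
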